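import Summits.CriticalPhenomena.PercolationContinuityZ3.Theorems.PercNearOneGluingNoHeavyLowerTailSahiCombMixFourSingleTwo
import Summits.CriticalPhenomena.PercolationContinuityZ3.Theorems.PercNearOneGluingNoHeavyLowerTailSahiMixtureHereditaryFive

/-!
# The comb (tensor-Bernstein) hierarchy for Sahi's `E_k`, XLVIII: the CUBE ↔ COIN TRANSFER for OR-steps, and the comb-level (5,2) singleton cell

Support file of the one-cut programme (crux `NoHeavyLowerTail`, stmt-CriticalPhenomena-4575; cell `prim-masterthm`, seat P3, gen 9;
`run/shared/lean/prim/prim-masterthm/prim-masterthm-p3/HIERARCHY.md` §17).  Vocabulary: `SahiCombDisjunct.orCoord` (OR a coordinate of the cube into selected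
members), `SahiMixture.coinWeight` / `SahiMixture.orCoin` (OR an EXTERNAL independent coin into selected members of events on an arbitrary finite space),
`SahiCombMix.mixCoord` and its block moments (`…SahiCombMixCoord`), the law-level (5,2) cell `SahiMixture.sahiE_five_orCoin_two_eq` (`…SahiMixtureHereditaryFive`).

* **`sahiE_orCoord_eq_coin`** — THE TRANSFER (every `n`, every selector `G`): for events `U_j` of the cube ignoring `e`,
  `E_n(μ_p; (U_j ∪ [G j]{e ∈ ω})_j) = E_n(μ_p ⊗ coin(p_e); (orCoin U_j (G j))_j)` — the cube row IS the law-level coin-mixture row of the SAME product weight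
  viewed as an abstract law, with bias `h = p_e`.  (All mixed block moments agree: `(1 − p_e)·μ_p(U_S) + p_e·μ_p(U_{S∖G})`, `ex_prod_ind_orCoord` /
  `ex_prod_ind_orCoin`; then `sahiE_congr_of_moments`.)  Consequently every law-level mixture IDENTITY of the `…SahiMixture*` files holds verbatim on the cube —
  gens 7–8 re-derived the three- and four-slot cells by hand; from now on this is one rewrite.
* **`combPos_five_orCoord_two`** — THE COMB (5,2) SINGLETON CELL: for FIVE events `U_0,…,U_4` of a finite cube ignoring `e` with `CombHereditary U`, the top row
  `p ↦ E_5(μ_p; U_0∪{e∈ω}, U_1∪{e∈ω}, U_2, U_3, U_4)` is comb-positive at multidegree `5`.  Proof: transfer + the closed identity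
  `(1−p_e)²E_5(U) + p_e(1−p_e)W + 6p_e²E_3(U_2,U_3,U_4)`; every term of `W` is (a Venn-type nonnegative moment, comb-positive at multidegree `1` off `e` — `combPos_codefect01` of `…FourSingleTwo`, `combPos_defect01k_five`, `combPos_defect01_234_five`) × (a hereditary
  comb row off `e`), so `CombPos.mul/add` and the coordinate powers `p_e^a(1−p_e)^b` assemble it (ttrl cp-mix2's q = 1 certificates, MIXCOMB §18.6, lifted).
  No assembly to comb H-MIX(5) is claimed or possible (H-MIX(5) is false at the law level, `…SahiMixtureHereditaryCex5`); this is the surviving top cell.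
HONEST FRAMING: nothing here asserts (M⁺-k) or `C_k` for `k ≥ 3`. [this work]
-/

noncomputable section

open scoped Classical

namespace Summit.CriticalPhenomena.PercolationContinuityZ3.Theorems

open Finset Function
open Literature.Combinatorics.Sahi2008
open Literature.Probability.Percolation.BHK2006 (ind_le_one ind_inter)
open Literature.Probability.Percolation.DecisionTree (ind ind_of_mem ind_of_not_mem ind_nonneg)
open SahiComb
open SahiCombDisjunct (orCoord)
open SahiCombHereditary (CombHereditary)
open SahiMixture (coinWeight orCoin)

variable {ι : Type} [Fintype ι]

namespace SahiCombMix

/-! ### Block moments on both sides -/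

/-- A finite product of indicators is the indicator of the intersection. [folklore] -/
theorem finsetProd_ind_eq_ind_biInter {β : Type*} {n : ℕ} (V : Fin n → Set β) (S : Finset (Fin n)) :
    (∏ i ∈ S, ind (V i)) = ind (⋂ i ∈ S, V i) := by
  funext ω
  rw [Finset.prod_apply]
  induction S using Finset.induction_on with
  | empty => simp [ind_of_mem]
  | insert a S ha ih => rw [Finset.prod_insert ha, ih, Finset.set_biInter_insert, ind_inter]

/-- **Cube side**: mixed block moments of an OR-ed family, `μ_p(⋂_{i∈S}(U_i ∪ [G i]{e∈ω})) = (1 − p_e)·μ_p(U_S) + p_e·μ_p(U_{S∖G})`. [this work] -/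
theorem ex_prod_ind_orCoord {n : ℕ} (U : Fin n → Set (Set ι)) (e : ι) (G : Fin n → Bool)
    (hUe : ∀ (j : Fin n) (b : Bool), secAt e b (U j) = U j) (p : ι → unitInterval) (S : Finset (Fin n)) :
    ex (bernoulliWeight p) (∏ i ∈ S, ind (orCoord U e G i))
      = (1 - (p e : ℝ)) * ex (bernoulliWeight p) (ind (⋂ i ∈ S, U i))
        + (p e : ℝ) * ex (bernoulliWeight p) (ind (⋂ i ∈ S.filter (fun i => G i = false), U i)) := by
  rw [finsetProd_ind_eq_ind_biInter, biInter_orCoord_eq_mixCoord]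
  exact ex_ind_mixCoord e (secAt_biInter U e hUe S) (secAt_biInter U e hUe _)
    (fun ω hω => Set.mem_iInter₂.2 fun i hi => Set.mem_iInter₂.1 hω i (Finset.mem_filter.1 hi).1) p

/-- **Coin side**: the same block moments for an external coin of bias `h`. [this work] -/
theorem ex_prod_ind_orCoin {α : Type*} [Fintype α] (μ : α → ℝ) (h : ℝ) {n : ℕ} (A : Fin n → Set α) (G : Fin n → Bool) (S : Finset (Fin n)) :
    ex (coinWeight μ h) (∏ i ∈ S, ind (orCoin (A i) (G i)))
      = (1 - h) * ex μ (ind (⋂ i ∈ S, A i)) + h * ex μ (ind (⋂ i ∈ S.filter (fun i => G i = false), A i)) := by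
  rw [SahiMixture.ex_coinWeight]
  have e0 : (fun a => (∏ i ∈ S, ind (orCoin (A i) (G i))) (a, false)) = ind (⋂ i ∈ S, A i) := by
    rw [← finsetProd_ind_eq_ind_biInter]
    funext a
    rw [Finset.prod_apply, Finset.prod_apply]
    exact Finset.prod_congr rfl fun i _ => SahiMixture.ind_orCoin_false _ _ a
  have e1 : (fun a => (∏ i ∈ S, ind (orCoin (A i) (G i))) (a, true)) = ind (⋂ i ∈ S.filter (fun i => G i = false), A i) := by
    rw [← finsetProd_ind_eq_ind_biInter]
    funext a
    rw [Finset.prod_apply, Finset.prod_apply, Finset.prod_filter]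
    refine Finset.prod_congr rfl fun i _ => ?_
    rw [SahiMixture.ind_orCoin_true]
    cases G i <;> simp
  rw [e0, e1]

/-- **THE CUBE ↔ COIN TRANSFER.**  For events `U_j` ignoring `e`: `E_n(μ_p; orCoord U e G) = E_n(μ_p ⊗ coin(p_e); (orCoin U_j (G j))_j)`. [this work] -/
theorem sahiE_orCoord_eq_coin {n : ℕ} (U : Fin n → Set (Set ι)) (e : ι) (G : Fin n → Bool)
    (hUe : ∀ (j : Fin n) (b : Bool), secAt e b (U j) = U j) (p : ι → unitInterval) :
    sahiE (bernoulliWeight p) n (fun j => ind (orCoord U e G j))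
      = sahiE (coinWeight (bernoulliWeight p) (p e)) n (fun j => ind (orCoin (U j) (G j))) :=
  sahiE_congr_of_moments _ _ n _ _ fun S _ => by
    rw [ex_prod_ind_orCoord U e G hUe p S, ex_prod_ind_orCoin]

/-! ### The comb (5,2) singleton cell -/

section Five

variable (U : Fin 5 → Set (Set ι)) (e : ι) (hUe : ∀ (j : Fin 5) (b : Bool), secAt e b (U j) = U j)
include hUe

omit [Fintype ι] in
/-- Indicators of the `U_j` ignore `e`. [this work] -/
theorem ind_U5_insert (j : Fin 5) (ω : Set ι) : ind (U j) (insert e ω) = ind (U j) ω := by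
  rw [← hUe j true]; exact ind_secAt_insert e true (U j) ω

/-- The defect moments `μ_p(Ū_0Ū_1U_k) = μ_p(U_k) − μ_p(U_0U_k) − μ_p(U_1U_k) + μ_p(U_0U_1U_k)`, comb-positive at multidegree `1` off `e`. [this work] -/
theorem combPos_defect01k_five (k : Fin 5) :
    CombPos (update (fun _ : ι => 1) e 0) (fun p => ex (bernoulliWeight p) (ind (U k)) - ex (bernoulliWeight p) (ind (U 0) * ind (U k))
      - ex (bernoulliWeight p) (ind (U 1) * ind (U k)) + ex (bernoulliWeight p) (ind (U 0) * ind (U 1) * ind (U k))) := by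
  have h0 := (combPos_ex (ι := ι) (h := fun ω => (1 - ind (U 0) ω) * (1 - ind (U 1) ω) * ind (U k) ω) fun ω =>
      mul_nonneg (mul_nonneg (sub_nonneg.2 (ind_le_one (U 0) ω)) (sub_nonneg.2 (ind_le_one (U 1) ω))) (ind_nonneg (U k) ω)).of_ignores e
    fun p s => SahiCombDisjunct.ex_update_of_ignores' e (fun ω => by
      show (1 - ind (U 0) (insert e ω)) * (1 - ind (U 1) (insert e ω)) * ind (U k) (insert e ω)
          = (1 - ind (U 0) ω) * (1 - ind (U 1) ω) * ind (U k) ω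
      rw [ind_U5_insert U e hUe, ind_U5_insert U e hUe, ind_U5_insert U e hUe]) p s
  refine h0.congr fun p => ?_
  have ee := SahiMixture.ex_eq_lin (bernoulliWeight p) (fun ω => (1 - ind (U 0) ω) * (1 - ind (U 1) ω) * ind (U k) ω) ![1, -1, -1, 1]
    ![ind (U k), ind (U 0) * ind (U k), ind (U 1) * ind (U k), ind (U 0) * ind (U 1) * ind (U k)] (fun ω => by simp [Fin.sum_univ_succ]; ring)
  simp only [Fin.sum_univ_succ, Fin.sum_univ_zero, Matrix.cons_val_zero, Matrix.cons_val_succ] at ee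
  rw [ee]; ring

/-- The defect moment `μ_p(Ū_0Ū_1U_2U_3U_4)`, comb-positive at multidegree `1` off `e`. [this work] -/
theorem combPos_defect01_234_five :
    CombPos (update (fun _ : ι => 1) e 0) (fun p => ex (bernoulliWeight p) (ind (U 2) * ind (U 3) * ind (U 4))
      - ex (bernoulliWeight p) (ind (U 0) * ind (U 2) * ind (U 3) * ind (U 4)) - ex (bernoulliWeight p) (ind (U 1) * ind (U 2) * ind (U 3) * ind (U 4))
      + ex (bernoulliWeight p) (ind (U 0) * ind (U 1) * ind (U 2) * ind (U 3) * ind (U 4))) := by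
  have h0 := (combPos_ex (ι := ι) (h := fun ω => (1 - ind (U 0) ω) * (1 - ind (U 1) ω) * ind (U 2) ω * ind (U 3) ω * ind (U 4) ω) fun ω =>
      mul_nonneg (mul_nonneg (mul_nonneg (mul_nonneg (sub_nonneg.2 (ind_le_one (U 0) ω)) (sub_nonneg.2 (ind_le_one (U 1) ω)))
        (ind_nonneg (U 2) ω)) (ind_nonneg (U 3) ω)) (ind_nonneg (U 4) ω)).of_ignores e
    fun p s => SahiCombDisjunct.ex_update_of_ignores' e (fun ω => by
      show (1 - ind (U 0) (insert e ω)) * (1 - ind (U 1) (insert e ω)) * ind (U 2) (insert e ω) * ind (U 3) (insert e ω) * ind (U 4) (insert e ω)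
          = (1 - ind (U 0) ω) * (1 - ind (U 1) ω) * ind (U 2) ω * ind (U 3) ω * ind (U 4) ω
      rw [ind_U5_insert U e hUe, ind_U5_insert U e hUe, ind_U5_insert U e hUe, ind_U5_insert U e hUe, ind_U5_insert U e hUe]) p s
  refine h0.congr fun p => ?_
  have ee := SahiMixture.ex_eq_lin (bernoulliWeight p) (fun ω => (1 - ind (U 0) ω) * (1 - ind (U 1) ω) * ind (U 2) ω * ind (U 3) ω * ind (U 4) ω)
    ![1, -1, -1, 1]
    ![ind (U 2) * ind (U 3) * ind (U 4), ind (U 0) * ind (U 2) * ind (U 3) * ind (U 4), ind (U 1) * ind (U 2) * ind (U 3) * ind (U 4),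
      ind (U 0) * ind (U 1) * ind (U 2) * ind (U 3) * ind (U 4)] (fun ω => by simp [Fin.sum_univ_succ]; ring)
  simp only [Fin.sum_univ_succ, Fin.sum_univ_zero, Matrix.cons_val_zero, Matrix.cons_val_succ] at ee
  rw [ee]; ring

omit [Fintype ι] hUe in
/-- Degrees off `e` add. [folklore] -/
theorem deg_off_add_le {a b m : ℕ} (h : a + b ≤ m) :
    update (fun _ : ι => a) e 0 + update (fun _ : ι => b) e 0 ≤ update (fun _ : ι => m) e 0 := by
  intro x; by_cases hx : x = e
  · subst hx; simp
  · simp [hx, h]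

/-- **THE COMB (5,2) SINGLETON CELL.**  For five events ignoring `e` whose ∩-closed family is comb-positive at every order, OR-ing the coordinate `e` into
`U_0, U_1` gives a top row `E_5` that is comb-positive at multidegree `5`. [this work] -/
theorem combPos_five_orCoord_two (hU : CombHereditary U) :
    CombPos (fun _ : ι => 5) (fun p => sahiE (bernoulliWeight p) 5
      (fun j => ind (orCoord U e (![true, true, false, false, false] : Fin 5 → Bool) j))) := by
  have hI : ind (U 0 ∩ U 1) = ind (U 0) * ind (U 1) := funext fun ω => ind_inter _ _ ω
  -- the hereditary comb rows used, in moment form, off `e`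
  have eU : (fun j => ind (⋂ i ∈ (![({0} : Finset (Fin 5)), {1}, {2}, {3}, {4}] : Fin 5 → Finset (Fin 5)) j, U i))
      = ![ind (U 0), ind (U 1), ind (U 2), ind (U 3), ind (U 4)] := by
    funext j; fin_cases j <;> simp
  have eV : (fun j => ind (⋂ i ∈ (![({0, 1} : Finset (Fin 5)), {2}, {3}, {4}] : Fin 4 → Finset (Fin 5)) j, U i))
      = ![ind (U 0) * ind (U 1), ind (U 2), ind (U 3), ind (U 4)] := by
    funext j; fin_cases j <;> simp [hI]
  have eW : (fun j => ind (⋂ i ∈ (![({2} : Finset (Fin 5)), {3}, {4}] : Fin 3 → Finset (Fin 5)) j, U i)) = ![ind (U 2), ind (U 3), ind (U 4)] := by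
    funext j; fin_cases j <;> simp
  have eC : ∀ a b : Fin 5, (fun j => ind (⋂ i ∈ (![({a} : Finset (Fin 5)), {b}] : Fin 2 → Finset (Fin 5)) j, U i)) = ![ind (U a), ind (U b)] := by
    intro a b; funext j; fin_cases j <;> simp
  have r5 := hU.row_off e hUe 5 ![({0} : Finset (Fin 5)), {1}, {2}, {3}, {4}]
  rw [eU] at r5
  have r4 := (hU.row_off e hUe 4 ![({0, 1} : Finset (Fin 5)), {2}, {3}, {4}]).mono (deg_off_mono e (show 4 ≤ 5 by norm_num))
  rw [eV] at r4
  have r3 := hU.row_off e hUe 3 ![({2} : Finset (Fin 5)), {3}, {4}]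
  rw [eW] at r3
  have rC : ∀ a b : Fin 5, CombPos (update (fun _ : ι => 2) e 0)
      (fun p => ex (bernoulliWeight p) (ind (U a) * ind (U b)) - ex (bernoulliWeight p) (ind (U a)) * ex (bernoulliWeight p) (ind (U b))) := by
    intro a b
    have r2 := hU.row_off e hUe 2 ![({a} : Finset (Fin 5)), {b}]
    rw [eC a b] at r2
    refine r2.congr fun p => ?_
    rw [sahiE_two_apply]
    simp only [Matrix.cons_val_zero, Matrix.cons_val_one]
  -- the codefect moment `μ_p(Ū_0Ū_1)` (the four-member lemma of `…FourSingleTwo` on the sub-family `(U_0,U_1,U_2,U_3)`)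
  have hcod : CombPos (update (fun _ : ι => 1) e 0) (fun p => 1 - ex (bernoulliWeight p) (ind (U 0)) - ex (bernoulliWeight p) (ind (U 1))
      + ex (bernoulliWeight p) (ind (U 0) * ind (U 1))) :=
    combPos_codefect01 (![U 0, U 1, U 2, U 3] : Fin 4 → Set (Set ι)) e (by intro j b; fin_cases j <;> exact hUe _ b)
  -- the middle coefficient `W`, comb-positive at multidegree `5` off `e`
  have hW : CombPos (update (fun _ : ι => 5) e 0) (fun p =>
      3 * sahiE (bernoulliWeight p) 4 ![ind (U 0) * ind (U 1), ind (U 2), ind (U 3), ind (U 4)]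
        + (6 + 2 * (1 - ex (bernoulliWeight p) (ind (U 0)) - ex (bernoulliWeight p) (ind (U 1)) + ex (bernoulliWeight p) (ind (U 0) * ind (U 1))))
            * sahiE (bernoulliWeight p) 3 ![ind (U 2), ind (U 3), ind (U 4)]
        + (ex (bernoulliWeight p) (ind (U 4)) - ex (bernoulliWeight p) (ind (U 0) * ind (U 4)) - ex (bernoulliWeight p) (ind (U 1) * ind (U 4))
              + ex (bernoulliWeight p) (ind (U 0) * ind (U 1) * ind (U 4)))
            * (ex (bernoulliWeight p) (ind (U 2) * ind (U 3)) - ex (bernoulliWeight p) (ind (U 2)) * ex (bernoulliWeight p) (ind (U 3)))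
        + (ex (bernoulliWeight p) (ind (U 3)) - ex (bernoulliWeight p) (ind (U 0) * ind (U 3)) - ex (bernoulliWeight p) (ind (U 1) * ind (U 3))
              + ex (bernoulliWeight p) (ind (U 0) * ind (U 1) * ind (U 3)))
            * (ex (bernoulliWeight p) (ind (U 2) * ind (U 4)) - ex (bernoulliWeight p) (ind (U 2)) * ex (bernoulliWeight p) (ind (U 4)))
        + (ex (bernoulliWeight p) (ind (U 2)) - ex (bernoulliWeight p) (ind (U 0) * ind (U 2)) - ex (bernoulliWeight p) (ind (U 1) * ind (U 2))
              + ex (bernoulliWeight p) (ind (U 0) * ind (U 1) * ind (U 2)))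
            * (ex (bernoulliWeight p) (ind (U 3) * ind (U 4)) - ex (bernoulliWeight p) (ind (U 3)) * ex (bernoulliWeight p) (ind (U 4)))
        + 6 * (ex (bernoulliWeight p) (ind (U 2) * ind (U 3) * ind (U 4)) - ex (bernoulliWeight p) (ind (U 0) * ind (U 2) * ind (U 3) * ind (U 4))
              - ex (bernoulliWeight p) (ind (U 1) * ind (U 2) * ind (U 3) * ind (U 4))
              + ex (bernoulliWeight p) (ind (U 0) * ind (U 1) * ind (U 2) * ind (U 3) * ind (U 4)))) := by
    have t1 := r4.smul (by norm_num : (0:ℝ) ≤ 3)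
    have t2 : CombPos (update (fun _ : ι => 5) e 0) (fun p =>
        (6 + 2 * (1 - ex (bernoulliWeight p) (ind (U 0)) - ex (bernoulliWeight p) (ind (U 1)) + ex (bernoulliWeight p) (ind (U 0) * ind (U 1))))
          * sahiE (bernoulliWeight p) 3 ![ind (U 2), ind (U 3), ind (U 4)]) :=
      (((combPos_const (update (fun _ : ι => 1) e 0) (by norm_num : (0:ℝ) ≤ 6)).add
        (hcod.smul (by norm_num : (0:ℝ) ≤ 2))).mul_of_le r3 (deg_off_add_le e (by norm_num))).congr
        fun p => by ring
    have t3 := ((combPos_defect01k_five U e hUe 4).mul_of_le (rC 2 3) (deg_off_add_le e (show 1 + 2 ≤ 5 by norm_num)))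
    have t4 := ((combPos_defect01k_five U e hUe 3).mul_of_le (rC 2 4) (deg_off_add_le e (show 1 + 2 ≤ 5 by norm_num)))
    have t5 := ((combPos_defect01k_five U e hUe 2).mul_of_le (rC 3 4) (deg_off_add_le e (show 1 + 2 ≤ 5 by norm_num)))
    have t6 := ((combPos_defect01_234_five U e hUe).mono (deg_off_mono e (show 1 ≤ 5 by norm_num))).smul (by norm_num : (0:ℝ) ≤ 6)
    exact (((((t1.add t2).add t3).add t4).add t5).add t6).congr fun p => by ring
  -- assemble along `p_e`
  have d : (Pi.single e 2 + update (fun _ : ι => 5) e 0) ≤ fun _ : ι => 5 := fun x => by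
    by_cases hx : x = e
    · subst hx; simp
    · simp [hx]
  have s0 := (SahiCombDisjunct.combPos_coord_pow e 0 2).mul_of_le r5 d
  have s1 := (SahiCombDisjunct.combPos_coord_pow e 1 1).mul_of_le hW d
  have s2 := (SahiCombDisjunct.combPos_coord_pow e 2 0).mul_of_le
    ((r3.mono (deg_off_mono e (show 3 ≤ 5 by norm_num))).smul (by norm_num : (0:ℝ) ≤ 6)) d
  have efam : (fun j => ind (orCoin (U j) ((![true, true, false, false, false] : Fin 5 → Bool) j)))
      = ![ind (orCoin (U 0) true), ind (orCoin (U 1) true), ind (orCoin (U 2) false), ind (orCoin (U 3) false), ind (orCoin (U 4) false)] := by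
    funext j; fin_cases j <;> rfl
  refine ((s0.add s1).add s2).congr fun p => ?_
  rw [sahiE_orCoord_eq_coin U e _ hUe p, efam,
    SahiMixture.sahiE_five_orCoin_two_eq (sum_bernoulliWeight p) (U 0) (U 1) (U 2) (U 3) (U 4) (p e : ℝ)]
  ring

/-- Law-level shadow: `E_5(μ_p; U_0∪{e∈ω}, U_1∪{e∈ω}, U_2, U_3, U_4) ≥ 0` under every product measure. [this work] -/
theorem sahiE_five_orCoord_two_nonneg (hU : CombHereditary U) (p : ι → unitInterval) :
    0 ≤ sahiE (bernoulliWeight p) 5 (fun j => ind (orCoord U e (![true, true, false, false, false] : Fin 5 → Bool) j)) :=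
  (combPos_five_orCoord_two U e hUe hU).nonneg p

end Five

end SahiCombMix

end Summit.CriticalPhenomena.PercolationContinuityZ3.Theorems

end
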